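import Mathlib.Analysis.SpecialFunctions.Sqrt
import Mathlib.Analysis.SpecialFunctions.Log.Deriv
import Literature.Geometry.Lorentzian.StationaryOrbitProjection
import HarnessLib

/-!
# Descent of invariant functions to the orbit space; the lapse `u² = -⟨X, X⟩` on `S`
(Anderson 2000, §0: the data `(u, g_S, …)` of a stationary space-time live on `S`)

M. T. Anderson, *On stationary vacuum solutions to the Einstein equations*, Ann. Henri Poincaré 1
(2000), §0, (0.1)–(0.2): a stationary space-time is written `g_M = -u²(dt + θ)² + π^* g_S` with
`u : S → ℝ⁺`, `u² = -⟨X, X⟩ > 0`, a function **on the orbit space** `S`. For the smooth orbit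
3-manifold `S = OrbitSpace X` of a chronological stationary spacetime (slice charts,
`StationaryOrbitSpaceManifold.lean`) this file proves the descent principle behind this and
applies it to the lapse:

* `LorentzianMetric.IsStationaryKilling.contMDiff_of_comp_orbitProj` — **a function on `S` is
  `C^∞` as soon as its pull-back to `M` is `C^∞`** (in the slice chart at a representative `p`,
  `f ∘ e⁻¹ = (f ∘ π) ∘ σ` with `σ` the `C^∞` slice parametrisation; continuity from the quotient
  map `π`); with the trivial converse `contMDiff_comp_orbitProj_iff`;
* `Spacetime.IsStationaryKilling.lapseSq hX z` — **the lapse squared `u²(z) = -⟨X, X⟩`** at (a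
  representative event of) the orbit `z`, a `def`;
  `lapseSq_orbitProj` — `u²(π y) = -g_y(X, X)` at **every** event (`G`-invariance of `⟨X, X⟩`,
  `IsStationaryKilling.neg_val_self_apply_eq`); `lapseSq_pos` — `u² > 0`;
  `contMDiff_lapseSq` — **`u²` is `C^∞` on `S`** (descent of the `C^∞` invariant function
  `-⟨X, X⟩`, `IsKillingField.contMDiff_neg_val_self`);
* `Spacetime.IsStationaryKilling.contMDiff_of_comp_orbitProj` — the bundled descent principle.

No named facts; the one definition (`lapseSq`) depends on the hypothesis `hX` only through the
orbit space it lives on.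

## References

* M. T. Anderson, Ann. Henri Poincaré 1 (2000) 977–994, arXiv:gr-qc/0001091, §0, (0.1)–(0.2)
  (key `Anderson2000`).
* J. M. Lee, *Introduction to Smooth Manifolds*, 2nd ed. (2012), Thm. 4.29 (smooth maps descend
  through surjective smooth submersions) (key `LeeSmoothManifolds2013`).
-/

noncomputable section

open Bundle Set Filter Function Manifold TopologicalSpace
open scoped ContDiff Topology Manifold

namespace Literature.Geometry.Lorentzian

namespace LorentzianMetric

section Descent

variable {E : Type*} [NormedAddCommGroup E] [NormedSpace ℝ E] [FiniteDimensional ℝ E]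
  [CompleteSpace E] {M : Type*} [TopologicalSpace M] [ChartedSpace E M]
  [IsManifold 𝓘(ℝ, E) ∞ M] [T2Space M]
  {g : LorentzianMetric 𝓘(ℝ, E) ∞ M} [g.HasLeviCivita] {τ : TimeOrientation g}
  {X : Π x : M, TangentSpace 𝓘(ℝ, E) x} {θ : ℝ × M → M}
  {F : Type*} [NormedAddCommGroup F] [NormedSpace ℝ F] [FiniteDimensional ℝ F]
  {F'' : Type*} [NormedAddCommGroup F''] [NormedSpace ℝ F'']

/-- **Descent of smooth functions to the orbit space.** For the slice-chart smooth structure on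
`S = OrbitSpace X`, a map `f : S → F''` into a normed space is `C^∞` as soon as `f ∘ π : M → F''`
is `C^∞`: in the slice chart `e` at a representative `p` of `z`, `f ∘ e⁻¹ = (f ∘ π) ∘ σ` with `σ`
the `C^∞` slice parametrisation (`SliceData.contMDiffOn_param`, `chart_symm_apply`). This is the
special case, with explicit local sections, of Lee 2012, Thm. 4.29 (maps descend through
surjective smooth submersions); Anderson 2000, §0 uses it for `u`, `ω`, `φ`.
[cite: LeeSmoothManifolds2013, Thm. 4.29] -/
theorem IsStationaryKilling.contMDiff_of_comp_orbitProj (h : g.IsStationaryKilling τ X univ)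
    (hchr : g.IsChronological τ) (hθ : ContMDiff (𝓘(ℝ, ℝ).prod 𝓘(ℝ, E)) 𝓘(ℝ, E) ∞ θ)
    (hθ0 : ∀ p, θ (0, p) = p) (hθadd : ∀ t s p, θ (t, θ (s, p)) = θ (t + s, p))
    (hθX : ∀ p, IsMIntegralCurve (fun t ↦ θ (t, p)) X)
    (hF : Module.finrank ℝ F + 1 = Module.finrank ℝ E) {f : OrbitSpace X → F''}
    (hf : ContMDiff 𝓘(ℝ, E) 𝓘(ℝ, F'') ∞ (f ∘ orbitProj X)) :
    letI := h.orbitSpaceChartedSpace hchr (hθ.of_le (WithTop.coe_le_coe.mpr le_top)) hθ0 hθadd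
      hθX hF
    ContMDiff 𝓘(ℝ, F) 𝓘(ℝ, F'') ∞ f := by
  letI := h.orbitSpaceChartedSpace hchr (hθ.of_le (WithTop.coe_le_coe.mpr le_top)) hθ0 hθadd
    hθX hF
  haveI := h.isManifold_orbitSpace hchr hθ hθ0 hθadd hθX hF
  have hθ2 : ContMDiff (𝓘(ℝ, ℝ).prod 𝓘(ℝ, E)) 𝓘(ℝ, E) 2 θ :=
    hθ.of_le (WithTop.coe_le_coe.mpr le_top)
  intro z
  set p : M := z.out with hp
  set d : SliceData X θ F p := h.sliceDataAt hchr hθ2 hθ0 hθadd hθX hF p with hd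
  have hz : orbitProj X p = z := Quotient.out_eq z
  have hchart : chartAt F z = d.chart h.contMDiff_one hθX hθ0 := rfl
  have hzs : z ∈ (chartAt F z).source := mem_chart_source F z
  rw [contMDiffAt_iff_source_of_mem_source hzs]
  -- the source-side chart is `d.chart`, with inverse `π ∘ σ`
  have hu₀ : chartAt F z z ∈ d.dom := by
    rw [← d.chart_target h.contMDiff_one hθX hθ0, hchart]
    exact (d.chart h.contMDiff_one hθX hθ0).map_source (hchart ▸ hzs)
  have hloc : ContMDiffOn 𝓘(ℝ, F) 𝓘(ℝ, F'') ∞ ((f ∘ orbitProj X) ∘ d.param) d.dom :=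
    hf.comp_contMDiffOn d.contMDiffOn_param
  have hfun : f ∘ (extChartAt 𝓘(ℝ, F) z).symm = (f ∘ orbitProj X) ∘ d.param := by
    funext u
    simp only [comp_apply, extChartAt, OpenPartialHomeomorph.extend_coe_symm,
      modelWithCornersSelf_coe_symm, CompTriple.comp_eq, hchart]
    rfl
  rw [hfun]
  have hpt : extChartAt 𝓘(ℝ, F) z z = chartAt F z z := by simp
  rw [hpt]
  exact ((hloc.contMDiffAt (d.isOpen_dom.mem_nhds hu₀)).contMDiffWithinAt)

/-- A function on the orbit space is `C^∞` iff its pull-back to `M` is. [cite: LeeSmoothManifolds2013, Thm. 4.29] -/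
theorem IsStationaryKilling.contMDiff_comp_orbitProj_iff (h : g.IsStationaryKilling τ X univ)
    (hchr : g.IsChronological τ) (hθ : ContMDiff (𝓘(ℝ, ℝ).prod 𝓘(ℝ, E)) 𝓘(ℝ, E) ∞ θ)
    (hθ0 : ∀ p, θ (0, p) = p) (hθadd : ∀ t s p, θ (t, θ (s, p)) = θ (t + s, p))
    (hθX : ∀ p, IsMIntegralCurve (fun t ↦ θ (t, p)) X)
    (hF : Module.finrank ℝ F + 1 = Module.finrank ℝ E) {f : OrbitSpace X → F''} :
    letI := h.orbitSpaceChartedSpace hchr (hθ.of_le (WithTop.coe_le_coe.mpr le_top)) hθ0 hθadd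
      hθX hF
    ContMDiff 𝓘(ℝ, E) 𝓘(ℝ, F'') ∞ (f ∘ orbitProj X) ↔ ContMDiff 𝓘(ℝ, F) 𝓘(ℝ, F'') ∞ f := by
  letI := h.orbitSpaceChartedSpace hchr (hθ.of_le (WithTop.coe_le_coe.mpr le_top)) hθ0 hθadd
    hθX hF
  refine ⟨h.contMDiff_of_comp_orbitProj hchr hθ hθ0 hθadd hθX hF, fun hf ↦ ?_⟩
  exact hf.comp (h.contMDiff_orbitProj hchr hθ hθ0 hθadd hθX hF)

end Descent

end LorentzianMetric

/-! ### The lapse on the orbit 3-manifold of a stationary spacetime -/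

namespace Spacetime

universe u

variable {𝓢 : Spacetime.{u} 4} [𝓢.metric.HasLeviCivita]
  {X : Π x : 𝓢.carrier, TangentSpace (𝓡 4) x}

/-- `dim ℝ³ + 1 = dim ℝ⁴`. [folklore] -/
private lemma finrank_three_add_one_d :
    Module.finrank ℝ (EuclideanSpace ℝ (Fin 3)) + 1 =
      Module.finrank ℝ (EuclideanSpace ℝ (Fin 4)) := by
  simp [finrank_euclideanSpace]

/-- **Anderson 2000, §0, bundled form: smooth `G`-invariant data descend to `S`.** A function on
the orbit 3-manifold of a chronological stationary spacetime is `C^∞` as soon as its pull-back to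
the spacetime is. [cite: LeeSmoothManifolds2013, Thm. 4.29] -/
theorem IsStationaryKilling.contMDiff_of_comp_orbitProj (hX : 𝓢.IsStationaryKilling X univ)
    (hchr : 𝓢.metric.IsChronological 𝓢.timeOrientation) {F'' : Type*} [NormedAddCommGroup F'']
    [NormedSpace ℝ F''] {f : OrbitSpace X → F''}
    (hf : ContMDiff (𝓡 4) 𝓘(ℝ, F'') ∞ (f ∘ orbitProj X)) :
    letI := hX.orbitSpaceChartedSpace hchr
    ContMDiff (𝓡 3) 𝓘(ℝ, F'') ∞ f :=
  LorentzianMetric.IsStationaryKilling.contMDiff_of_comp_orbitProj hX hchr hX.contMDiff_flow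
    hX.flow_zero hX.flow_add hX.isMIntegralCurve_flow finrank_three_add_one_d hf

/-- **The lapse squared `u² = -⟨X, X⟩` as a function on the orbit space** `S` (evaluated at a
representative event of the orbit; `lapseSq_orbitProj` shows the choice is immaterial).
Anderson 2000, §0, (0.2): "`u² = -⟨X, X⟩ > 0`", `u : S → ℝ⁺`. [cite: Anderson2000, §0, (0.2)] -/
def IsStationaryKilling.lapseSq (_hX : 𝓢.IsStationaryKilling X univ) (z : OrbitSpace X) : ℝ :=
  -𝓢.metric.val z.out (X z.out) (X z.out)

/-- **`u²(π y) = -g_y(X, X)` at every event**: `⟨X, X⟩` is constant along the orbits of the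
stationary flow (`IsStationaryKilling.neg_val_self_apply_eq`). [cite: Anderson2000, §0, (0.2)] -/
theorem IsStationaryKilling.lapseSq_orbitProj (hX : 𝓢.IsStationaryKilling X univ)
    (y : 𝓢.carrier) : hX.lapseSq (orbitProj X y) = -𝓢.metric.val y (X y) (X y) := by
  have hX1 := hX.contMDiff_one
  have hc : IsCompleteVectorField X := fun x ↦
    ⟨fun t ↦ hX.flow (t, x), hX.isMIntegralCurve_flow x, hX.flow_zero x⟩
  have hmem : (orbitProj X y).out ∈ Literature.Geometry.Lorentzian.stationaryOrbit X {y} := by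
    rw [← orbitProj_eq_iff X hX1 hc]
    exact (Quotient.out_eq _).symm
  obtain ⟨t, ht⟩ := (mem_stationaryOrbit_singleton_iff_exists_flow_eq hX1
    hX.isMIntegralCurve_flow hX.flow_zero).1 hmem
  have key := LorentzianMetric.IsStationaryKilling.neg_val_self_apply_eq hX
    (hX.isMIntegralCurve_flow y) t 0
  rw [hX.flow_zero, ht] at key
  exact key

/-- **The lapse is positive**: `u² > 0` on `S`. Anderson 2000, §0, (0.2). [cite: Anderson2000, §0, (0.2)] -/
theorem IsStationaryKilling.lapseSq_pos (hX : 𝓢.IsStationaryKilling X univ) (z : OrbitSpace X) :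
    0 < hX.lapseSq z :=
  LorentzianMetric.IsStationaryKilling.neg_val_self_pos hX z.out

/-- **The lapse is a `C^∞` function on the orbit 3-manifold** (descent of the `C^∞` invariant
function `-⟨X, X⟩`, `IsKillingField.contMDiff_neg_val_self`). Anderson 2000, §0 (`u : S → ℝ⁺`
is part of the smooth data `(S, g_S, u, θ)` of (0.1)). [cite: Anderson2000, §0, (0.1)–(0.2)] -/
theorem IsStationaryKilling.contMDiff_lapseSq (hX : 𝓢.IsStationaryKilling X univ)
    (hchr : 𝓢.metric.IsChronological 𝓢.timeOrientation) :
    letI := hX.orbitSpaceChartedSpace hchr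
    ContMDiff (𝓡 3) 𝓘(ℝ, ℝ) ∞ hX.lapseSq := by
  refine hX.contMDiff_of_comp_orbitProj hchr ?_
  have hfun : hX.lapseSq ∘ orbitProj X = fun y ↦ -𝓢.metric.val y (X y) (X y) :=
    funext fun y ↦ hX.lapseSq_orbitProj y
  rw [hfun]
  exact hX.isKillingField.contMDiff_neg_val_self

/-! ### The lapse `u` and the potential `log u` (appended) -/

/-- **The lapse `u = (-⟨X, X⟩)^{1/2} : S → ℝ⁺`** of a chronological stationary spacetime, as a
function on the orbit space (Anderson 2000, §0, (0.1)–(0.2): `g_M = -u²(dt + θ)² + π^* g_S`,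
`u > 0` on `S`). [cite: Anderson2000, §0, (0.1)–(0.2)] -/
def IsStationaryKilling.lapse (hX : 𝓢.IsStationaryKilling X univ) (z : OrbitSpace X) : ℝ :=
  Real.sqrt (hX.lapseSq z)

/-- `u > 0`. Anderson 2000, §0, (0.2). [cite: Anderson2000, §0, (0.2)] -/
theorem IsStationaryKilling.lapse_pos (hX : 𝓢.IsStationaryKilling X univ) (z : OrbitSpace X) :
    0 < hX.lapse z :=
  Real.sqrt_pos.2 (hX.lapseSq_pos z)

/-- `u² = -⟨X, X⟩` (the square of the lapse is `lapseSq`). [cite: Anderson2000, §0, (0.2)] -/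
theorem IsStationaryKilling.lapse_sq (hX : 𝓢.IsStationaryKilling X univ) (z : OrbitSpace X) :
    hX.lapse z ^ 2 = hX.lapseSq z :=
  Real.sq_sqrt (hX.lapseSq_pos z).le

/-- `u(π y) = (-g_y(X, X))^{1/2}` at every event. [cite: Anderson2000, §0, (0.2)] -/
theorem IsStationaryKilling.lapse_orbitProj (hX : 𝓢.IsStationaryKilling X univ) (y : 𝓢.carrier) :
    hX.lapse (orbitProj X y) = Real.sqrt (-𝓢.metric.val y (X y) (X y)) := by
  rw [IsStationaryKilling.lapse, hX.lapseSq_orbitProj]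

/-- **The lapse `u` is `C^∞` on `S`** (`u²` is `C^∞` and positive; `√·` is `C^∞` away from `0`).
[cite: Anderson2000, §0, (0.1)–(0.2)] -/
theorem IsStationaryKilling.contMDiff_lapse (hX : 𝓢.IsStationaryKilling X univ)
    (hchr : 𝓢.metric.IsChronological 𝓢.timeOrientation) :
    letI := hX.orbitSpaceChartedSpace hchr
    ContMDiff (𝓡 3) 𝓘(ℝ, ℝ) ∞ hX.lapse := by
  letI := hX.orbitSpaceChartedSpace hchr
  intro z
  exact (Real.contDiffAt_sqrt (hX.lapseSq_pos z).ne').comp_contMDiffAt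
    (hX.contMDiff_lapseSq hchr z)

/-- **The potential `ν = log u` is `C^∞` on `S`** (Anderson 2000, (1.4)–(1.6): the stationary
vacuum equations are written in terms of `ν = log u`). [cite: Anderson2000, §1.2, (1.4)–(1.6)] -/
theorem IsStationaryKilling.contMDiff_log_lapse (hX : 𝓢.IsStationaryKilling X univ)
    (hchr : 𝓢.metric.IsChronological 𝓢.timeOrientation) :
    letI := hX.orbitSpaceChartedSpace hchr
    ContMDiff (𝓡 3) 𝓘(ℝ, ℝ) ∞ (fun z ↦ Real.log (hX.lapse z)) := by
  letI := hX.orbitSpaceChartedSpace hchr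
  intro z
  exact (Real.contDiffAt_log.2 (hX.lapse_pos z).ne').comp_contMDiffAt
    (hX.contMDiff_lapse hchr z)

end Spacetime

end Literature.Geometry.Lorentzian

end
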